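import Summits.CriticalPhenomena.PercolationContinuityZ3.Theorems.PercNearOneGluingAdditiveGluingGenPair
import Literature.Probability.Percolation.KozmaNitzanSeparatingTriple
import HarnessLib

/-!
# Kozma–Nitzan's Question 8 for three relays — the z-FREE pocket covariance comparison (PC0), PROVED
# (the pocket analogue of the four-point inequality `AGloc.surplusTransfer_single`: Harris + van den Berg–Häggström–Kahn with sets)

Support file (`--supports stmt-CriticalPhenomena-4575`, closed), prover `prim-lf-2` (gen 16).  No definitions, no named facts, no sorries;
standard axioms.  Memo `prim-lf-2/POCKET-CERT-gen16.md` §4; companions `…KnQuestion8PocketCertificate.lean`, `…KnQuestion8PocketPieces.lean`.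

The pocket-designated certificate for Question 8 at `|A| = 3` (memo §3) needs, on the `x`-side, the POCKET COVARIANCE COMPARISON PCOV —
the tree's COV(τ) (`CovTau.covTau`) with every reference event intersected with the pocket `{C_o ∩ A = ∅}`.  As for COV(τ), whose
`z`-free core is the four-point inequality 4PT = `AGloc.surplusTransfer_single` (Harris on `{o ↔ {x,y}}` + vdBHK Thm 1.4), the `z`-free core of
PCOV has a two-line proof, recorded here.  Owner `x`, observer `o`, marker `y` (no third relay), `F` monotone nonnegative on vertex sets,
`I_S = ∫_S F(C x)`, events of one percolation `μ = prodBernoulli w`: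
  `O = {x↔o}`, `Y' = {x↔y} ∩ {x↮o}`, `E3 = {x↮o} ∩ {x↮y} ∩ {o↮y}`, `R = {x↮o} ∩ {x↮y} ∩ {o↔y}`, `N = {o↮x} ∩ {o↮y} = Y' ⊔ E3`, `n = μ(N)`.
* `PocketCert.pcov_zfree` — **(PC0)**  `μ(E3)·(n·I_O − (1−n)·I_{Y'}) ≥ (n·μ(O) − (1−n)·μ(Y'))·I_{E3}`,
  i.e. `μ(o↮{x,y})·μ(o∈C x)·[E(F|o∈C x) − E(F|E3)] ≥ μ(o↔{x,y})·μ(Y')·[E(F|Y') − E(F|E3)]`: the pocket-tilted mean of `F(C x)` never beats the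
  observer-tilted one by more than the odds `μ(o↔{x,y})/μ(o↮{x,y})` allow.  PROOF (exact identity, memo §4):
  `μ(E3)(n I_O − (1−n) I_{Y'}) − (n μ(O) − (1−n) μ(Y')) I_{E3} = μ(E3)·[I_{O ⊔ R} − μ(O ⊔ R)·∫F] + n·[μ(R)·I_{E3 ⊔ R} − μ(E3 ⊔ R)·I_R]`,
  using `Ω = O ⊔ Y' ⊔ E3 ⊔ R`; the first bracket is HARRIS for the increasing event `O ⊔ R = {o↔x} ∪ {o↔y}` (`AGloc.setIntegral_clusterFun_ge`),
  the second is vdBHK's Theorem 2.1 at `q = 1` for `S = {x}`, `T = {o,y}`: given `{x ↮ {o,y}} = E3 ⊔ R`, `F(C x)` and `1{o↔y}` (an increasing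
  function of the edge cluster `C_T`) are negatively correlated (`BHK2006_twoSetConditionalAssociation.negCorrelation`).
With the avoided relay `z` put back (all events intersected with `{x↮z}`, `o↮z` added to the pocket) this is PCOV, OPEN (memo §5: not in the
cone of the tree's covariance rows; 0 violations in 25 469 exact instances).
[cite: KozmaNitzan2024, Question 8 (§5.5 p. 36), §5.1 (pp. 31–32)] [cite: VandenbergHaggstromKahn2005, Thm. 2.1 (p. 9), Thm. 1.4 (p. 7), §1 p. 6]
-/

namespace Summit.CriticalPhenomena.PercolationContinuityZ3.Theorems

open MeasureTheory Set Literature.Probability.LatticeModels Literature.Probability.Percolation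
open scoped Classical
open KNPreFKG

noncomputable section

namespace PocketCert

variable {V : Type*} [Fintype V]

/-- **(PC0) — the `z`-free pocket covariance comparison.**  Owner `x`, observer `o`, marker `y`, `F` monotone nonnegative;
`O = {x↔o}`, `Y' = {x↔y} ∩ {x↮o}`, `E3 = {x↮o} ∩ {x↮y} ∩ {o↮y}`, `N = {o↮x} ∩ {o↮y}`.  Then
`μ(E3)·(μ(N)·∫_O F(C x) − (1 − μ(N))·∫_{Y'} F(C x)) ≥ (μ(N)·μ(O) − (1 − μ(N))·μ(Y'))·∫_{E3} F(C x)`.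
Harris on `{o↔x} ∪ {o↔y}` plus van den Berg–Häggström–Kahn's Thm 2.1 (`q = 1`) for `S = {x}`, `T = {o, y}`.
[cite: VandenbergHaggstromKahn2005, Thm. 2.1 (p. 9), §1 p. 6] [cite: KozmaNitzan2024, Question 8 (§5.5 p. 36)] -/
theorem pcov_zfree (w : Sym2 V → unitInterval) (o x y : V) (F : Set V → ℝ)
    (hF : ∀ S T : Set V, S ⊆ T → F S ≤ F T) (hF0 : ∀ S, 0 ≤ F S) :
    ((prodBernoulli w).real ({ω : BondConfig V | ¬ (openGraph ω).Reachable o x} ∩ {ω | ¬ (openGraph ω).Reachable o y}) *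
          (prodBernoulli w).real (openConn x o) -
        (1 - (prodBernoulli w).real ({ω : BondConfig V | ¬ (openGraph ω).Reachable o x} ∩ {ω | ¬ (openGraph ω).Reachable o y})) *
          (prodBernoulli w).real (openConn x y ∩ {ω | ¬ (openGraph ω).Reachable x o})) *
      ∫ ω in {ω : BondConfig V | ¬ (openGraph ω).Reachable x o} ∩ {ω | ¬ (openGraph ω).Reachable x y} ∩
          {ω | ¬ (openGraph ω).Reachable o y}, F (openCluster ω x) ∂(prodBernoulli w) ≤
    (prodBernoulli w).real ({ω : BondConfig V | ¬ (openGraph ω).Reachable x o} ∩ {ω | ¬ (openGraph ω).Reachable x y} ∩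
          {ω | ¬ (openGraph ω).Reachable o y}) *
      ((prodBernoulli w).real ({ω : BondConfig V | ¬ (openGraph ω).Reachable o x} ∩ {ω | ¬ (openGraph ω).Reachable o y}) *
          ∫ ω in openConn x o, F (openCluster ω x) ∂(prodBernoulli w) -
        (1 - (prodBernoulli w).real ({ω : BondConfig V | ¬ (openGraph ω).Reachable o x} ∩ {ω | ¬ (openGraph ω).Reachable o y})) *
          ∫ ω in openConn x y ∩ {ω | ¬ (openGraph ω).Reachable x o}, F (openCluster ω x) ∂(prodBernoulli w)) := by
  classical
  set μ := prodBernoulli w with hμ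
  set f : BondConfig V → ℝ := fun ω => F (openCluster ω x) with hf
  have hmeas : ∀ S' : Set (BondConfig V), MeasurableSet S' := fun _ => MeasurableSet.of_discrete
  have hint : ∀ (g : BondConfig V → ℝ) (S' : Set (BondConfig V)), IntegrableOn g S' μ :=
    fun g S' => (Integrable.of_finite).integrableOn
  have hn := fun (S' : Set (BondConfig V)) => (measureReal_nonneg : 0 ≤ μ.real S')
  -- the four cells
  set O : Set (BondConfig V) := openConn x o with hO
  set Yp : Set (BondConfig V) := openConn x y ∩ {ω | ¬ (openGraph ω).Reachable x o} with hYp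
  set E3 : Set (BondConfig V) := {ω : BondConfig V | ¬ (openGraph ω).Reachable x o} ∩ {ω | ¬ (openGraph ω).Reachable x y} ∩
      {ω | ¬ (openGraph ω).Reachable o y} with hE3
  set R : Set (BondConfig V) := ({ω : BondConfig V | ¬ (openGraph ω).Reachable x o} ∩ {ω | ¬ (openGraph ω).Reachable x y}) ∩
      openConn o y with hR
  set N : Set (BondConfig V) := {ω : BondConfig V | ¬ (openGraph ω).Reachable o x} ∩ {ω | ¬ (openGraph ω).Reachable o y} with hN
  set T0 : Set (BondConfig V) := {ω : BondConfig V | ¬ (openGraph ω).Reachable x o} ∩ {ω | ¬ (openGraph ω).Reachable x y} with hT0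
  set U : Set (BondConfig V) := openConn o x ∪ openConn o y with hU
  set m : ℝ := ∫ ω, f ω ∂μ with hm
  -- set identities
  have hNeq : N = Yp ∪ E3 := by
    ext ω
    simp only [hN, hYp, hE3, mem_inter_iff, mem_union, mem_setOf_eq, openConn]
    constructor
    · rintro ⟨hox, hoy⟩
      by_cases hxy : (openGraph ω).Reachable x y
      · exact Or.inl ⟨hxy, fun h => hox h.symm⟩
      · exact Or.inr ⟨⟨fun h => hox h.symm, hxy⟩, hoy⟩
    · rintro (⟨hxy, hxo⟩ | ⟨⟨hxo, hxy⟩, hoy⟩)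
      · exact ⟨fun h => hxo h.symm, fun h => hxo (hxy.trans h.symm)⟩
      · exact ⟨fun h => hxo h.symm, hoy⟩
  have hdYE : Disjoint Yp E3 := by
    rw [Set.disjoint_left]
    rintro ω ⟨hxy, -⟩ ⟨⟨-, hxy'⟩, -⟩
    exact hxy' hxy
  have hUeq : U = O ∪ R := by
    ext ω
    simp only [hU, hO, hR, mem_inter_iff, mem_union, mem_setOf_eq, openConn]
    constructor
    · rintro (hox | hoy)
      · exact Or.inl hox.symm
      · by_cases hxo : (openGraph ω).Reachable x o
        · exact Or.inl hxo
        · exact Or.inr ⟨⟨hxo, fun hxy => hxo (hxy.trans hoy.symm)⟩, hoy⟩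
    · rintro (hxo | ⟨⟨-, -⟩, hoy⟩)
      · exact Or.inl hxo.symm
      · exact Or.inr hoy
  have hdOR : Disjoint O R := by
    rw [Set.disjoint_left]
    rintro ω hxo ⟨⟨hxo', -⟩, -⟩
    exact hxo' hxo
  have hT0eq : T0 = E3 ∪ R := by
    ext ω
    simp only [hT0, hE3, hR, mem_inter_iff, mem_union, mem_setOf_eq, openConn]
    constructor
    · rintro ⟨hxo, hxy⟩
      by_cases hoy : (openGraph ω).Reachable o y
      · exact Or.inr ⟨⟨hxo, hxy⟩, hoy⟩
      · exact Or.inl ⟨⟨hxo, hxy⟩, hoy⟩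
    · rintro (⟨⟨hxo, hxy⟩, -⟩ | ⟨⟨hxo, hxy⟩, -⟩)
      · exact ⟨hxo, hxy⟩
      · exact ⟨hxo, hxy⟩
  have hdER : Disjoint E3 R := by
    rw [Set.disjoint_left]
    rintro ω ⟨-, hoy⟩ ⟨-, hoy'⟩
    exact hoy hoy'
  have hT0R : T0 ∩ openConn o y = R := rfl
  -- the whole space: `univ = (O ∪ R) ∪ (Yp ∪ E3)` (i.e. `U ⊔ N`)
  have hUN : Disjoint (O ∪ R) (Yp ∪ E3) := by
    rw [Set.disjoint_left]
    rintro ω (hxo | ⟨⟨hxo, hxy⟩, hoy⟩) (⟨hxy', hxo'⟩ | ⟨⟨hxo', hxy'⟩, hoy'⟩)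
    · exact hxo' hxo
    · exact hxo' hxo
    · exact hxy hxy'
    · exact hoy' hoy
  have huniv : (O ∪ R) ∪ (Yp ∪ E3) = univ := by
    rw [← hUeq, ← hNeq]
    ext ω
    simp only [hU, hN, mem_union, mem_inter_iff, mem_setOf_eq, mem_univ, iff_true, openConn]
    by_cases hox : (openGraph ω).Reachable o x
    · exact Or.inl (Or.inl hox)
    · by_cases hoy : (openGraph ω).Reachable o y
      · exact Or.inl (Or.inr hoy)
      · exact Or.inr ⟨hox, hoy⟩
  -- masses and integrals over the cells
  have eN : μ.real N = μ.real Yp + μ.real E3 := by rw [hNeq, measureReal_union hdYE (hmeas _)]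
  have eU : μ.real U = μ.real O + μ.real R := by rw [hUeq, measureReal_union hdOR (hmeas _)]
  have eT0 : μ.real T0 = μ.real E3 + μ.real R := by rw [hT0eq, measureReal_union hdER (hmeas _)]
  have e1 : 1 = (μ.real O + μ.real R) + (μ.real Yp + μ.real E3) := by
    rw [← measureReal_union hdOR (hmeas _), ← measureReal_union hdYE (hmeas _), ← measureReal_union hUN (hmeas _), huniv,
      probReal_univ]
  have iU : ∫ ω in U, f ω ∂μ = ∫ ω in O, f ω ∂μ + ∫ ω in R, f ω ∂μ := by
    rw [hUeq, setIntegral_union hdOR (hmeas _) (hint _ _) (hint _ _)]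
  have iT0 : ∫ ω in T0, f ω ∂μ = ∫ ω in E3, f ω ∂μ + ∫ ω in R, f ω ∂μ := by
    rw [hT0eq, setIntegral_union hdER (hmeas _) (hint _ _) (hint _ _)]
  have im : m = (∫ ω in O, f ω ∂μ + ∫ ω in R, f ω ∂μ) + (∫ ω in Yp, f ω ∂μ + ∫ ω in E3, f ω ∂μ) := by
    rw [← setIntegral_union hdOR (hmeas _) (hint _ _) (hint _ _), ← setIntegral_union hdYE (hmeas _) (hint _ _) (hint _ _),
      ← setIntegral_union hUN (hmeas _) (hint _ _) (hint _ _), huniv, setIntegral_univ]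
  -- (1) Harris on `U = {o↔x} ∪ {o↔y}`
  have hHarris : μ.real U * m ≤ ∫ ω in U, f ω ∂μ :=
    AGloc.setIntegral_clusterFun_ge w x F hF hF0 U ((isUpperSet_openConn o x).union (isUpperSet_openConn o y))
  -- (2) van den Berg–Häggström–Kahn Thm 2.1 for `S = {x}`, `T = {o, y}`: `F(C x)` vs `1{o↔y}` given `x ↮ {o,y}`
  set S : Set V := {x} with hS
  set T : Set V := {o, y} with hT
  set Fe : Set (Sym2 V) → ℝ := fun C => F (openCluster C x) with hFe
  set Ge : Set (Sym2 V) → ℝ := fun C => if (openGraph C).Reachable o y then 1 else 0 with hGe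
  have hFe_mono : Monotone Fe := fun C C' hCC' => hF _ _ (openCluster_mono hCC' x)
  have hGe_mono : Monotone Ge := by
    intro C C' hCC'
    simp only [hGe]
    by_cases h : (openGraph C).Reachable o y
    · rw [if_pos h, if_pos (h.mono (openGraph_mono hCC'))]
    · rw [if_neg h]; split_ifs <;> norm_num
  have hD_ST : {ω : BondConfig V | ∀ s ∈ S, ∀ t ∈ T, ¬ (openGraph ω).Reachable s t} = T0 := by
    ext ω
    simp only [hS, hT, hT0, mem_setOf_eq, mem_inter_iff, mem_insert_iff, mem_singleton_iff, forall_eq_or_imp, forall_eq]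
  have hFe_eq : ∀ ω : BondConfig V, Fe (⋃ s ∈ S, openEdgeCluster ω s) = f ω := by
    intro ω
    simp only [hFe, hf]
    congr 1
    ext a
    exact (KNSep.reachable_iff_cluster ω S (show x ∈ S by simp [hS]) a).symm
  have hGe_eq : ∀ ω : BondConfig V, Ge (⋃ t ∈ T, openEdgeCluster ω t) = (openConn o y : Set (BondConfig V)).indicator 1 ω := by
    intro ω
    simp only [hGe]
    rw [← KNSep.reachable_iff_cluster ω T (show o ∈ T by simp [hT]) y]
    by_cases h : (openGraph ω).Reachable o y
    · rw [if_pos h, indicator_of_mem (show ω ∈ openConn o y from h), Pi.one_apply]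
    · rw [if_neg h, indicator_of_notMem (show ω ∉ openConn o y from h)]
  have hBHK := BHK2006_twoSetConditionalAssociation.negCorrelation w S T Fe Ge hFe_mono hGe_mono
  rw [hD_ST] at hBHK
  simp_rw [hFe_eq, hGe_eq] at hBHK
  rw [setIntegral_mul_indicator_one μ T0 (openConn o y) f, setIntegral_indicator_one_eq μ T0 (openConn o y), hT0R] at hBHK
  -- hBHK : μ T0 * ∫_R f ≤ (∫_{T0} f) * μ R
  -- assemble via the identity  μ(E3)(n I_O − (1−n) I_Yp) − (n μO − (1−n) μYp) I_E3 = μ(E3)[I_U − μ(U) m] + n[μ(R) I_T0 − μ(T0) I_R]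
  rw [iU] at hHarris
  rw [iT0] at hBHK
  rw [eU] at hHarris
  rw [eT0] at hBHK
  have h1 : 0 ≤ μ.real E3 * ((∫ ω in O, f ω ∂μ + ∫ ω in R, f ω ∂μ) - (μ.real O + μ.real R) * m) :=
    mul_nonneg (hn E3) (by linarith)
  have h2 : 0 ≤ μ.real N * (μ.real R * (∫ ω in E3, f ω ∂μ + ∫ ω in R, f ω ∂μ) - (μ.real E3 + μ.real R) * ∫ ω in R, f ω ∂μ) :=
    mul_nonneg (hn N) (by linarith)
  have key : μ.real E3 * (μ.real N * ∫ ω in O, f ω ∂μ - (1 - μ.real N) * ∫ ω in Yp, f ω ∂μ) -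
      (μ.real N * μ.real O - (1 - μ.real N) * μ.real Yp) * ∫ ω in E3, f ω ∂μ =
      μ.real E3 * ((∫ ω in O, f ω ∂μ + ∫ ω in R, f ω ∂μ) - (μ.real O + μ.real R) * m) +
        μ.real N * (μ.real R * (∫ ω in E3, f ω ∂μ + ∫ ω in R, f ω ∂μ) - (μ.real E3 + μ.real R) * ∫ ω in R, f ω ∂μ) := by
    rw [im, eN]
    linear_combination ((μ.real Yp + μ.real E3) * (∫ ω in E3, f ω ∂μ) -
      μ.real E3 * ((∫ ω in O, f ω ∂μ + ∫ ω in R, f ω ∂μ) + (∫ ω in Yp, f ω ∂μ + ∫ ω in E3, f ω ∂μ))) * e1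
  have : 0 ≤ μ.real E3 * (μ.real N * ∫ ω in O, f ω ∂μ - (1 - μ.real N) * ∫ ω in Yp, f ω ∂μ) -
      (μ.real N * μ.real O - (1 - μ.real N) * μ.real Yp) * ∫ ω in E3, f ω ∂μ := by
    rw [key]; exact add_nonneg h1 h2
  simpa only [hf] using (sub_nonneg.1 this)

end PocketCert

end

end Summit.CriticalPhenomena.PercolationContinuityZ3.Theorems
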